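import Literature.NumberTheory.PAdicHodge.TateInvariantsBase
import HarnessLib

/-!
# Tate's theorem `H⁰(Γ_F, ℂ_F(χ^j)) = 0` (`j ≠ 0`) for a `p`-adic local field `F`

Continuation of `TateInvariantsBase`, which proves the statement for the Galois group
`G₀ = Gal(F̄/ℚ_p)` of the BASE field. Here we descend to the local field `F` itself, i.e. to the
subgroup `Γ_F = Gal(F̄/F) ≤ G₀` of finite index `d = [F : ℚ_p]`:

**Theorem** (`CompletedAlgClosure.eq_zero_of_forall_smul_eq_cyclotomicCharacter_zpow`). Let `F` be
a non-archimedean local field of characteristic `0` and residue characteristic `p`, `χ_F : Γ_F → ℤ_pˣ`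
the cyclotomic character, `j ∈ ℤ ∖ {0}`. If `x ∈ ℂ_F` satisfies `σ • x = χ_F(σ)^j · x` for all
`σ ∈ Γ_F` (the scalar `χ_F(σ)^j` acting through `ℤ_p ⊆ ℚ_p → F → ℂ_F`), then `x = 0`. In other words
`ℂ_F(χ^{-j})^{Γ_F} = 0` for every `j ≠ 0` — Tate 1967, §3.3, Theorem 2 (the `H⁰` half), the
input for `B_HT^{Γ_F} = B_dR^{Γ_F} = F` (`gr^j B_dR = ℂ_F(j)`) in Fontaine's formalism.

The descent is a norm argument (group theory only, a "multiplicative transfer"): choose for each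
`ℚ_p`-embedding `φ : F → F̄` an extension `s_φ ∈ G₀` (`liftEmb`); for `g ∈ G₀` one has
`g s_φ = s_{gφ} h_φ` with `h_φ ∈ Γ_F` (`corr`, `exists_toBase_eq_corr`), hence for
`y = ∏_φ s_φ • x` we get `g • y = (∏_φ χ(h_φ))^j y = χ(g)^{dj} y` (the products of `χ(s_φ)` and
`χ(s_{gφ})` cancel after reindexing by the permutation `φ ↦ gφ`). By the theorem over the base,
`y = 0`, so some `s_φ • x = 0`, so `x = 0`.

## References

* J. Tate, *p-divisible groups* (1967), §3.3, Theorem 2. [Tate1967]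
* J.-M. Fontaine, *Le corps des périodes p-adiques*, Astérisque 223 (1994), Exp. II §1.5
  (`B_dR^{G_K} = K`, via Tate's theorem). [FontaineAsterisque223III]
* J.-M. Fontaine, Y. Ouyang, *Theory of p-adic Galois representations*, §3.2. [FontaineOuyang2022]
-/

noncomputable section

open ValuativeRel Field UniformSpace Finset

namespace Literature.NumberTheory.PAdicHodge

open Literature.NumberTheory.GaloisRepresentations
open Literature.NumberTheory.GaloisRepresentations.IsNonarchimedeanLocalField
open CyclotomicTower

variable {F : Type} [Field F] [ValuativeRel F] [TopologicalSpace F] [IsNonarchimedeanLocalField F]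
  [CharZero F] {p : ℕ} [Fact p.Prime] (hp : valuation F p < 1)

namespace TateDescent

/-! ### `ℚ_p`-embeddings of `F` and coset representatives of `Γ_F` in `G₀` -/

/-- The (finite) type of `K₀`-embeddings `F → F̄`. [folklore] -/
abbrev Emb : Type := F →ₐ[PadicBase F p hp] NormedAlgClosure F

/-- `Emb` is finite (`F/K₀` is finite-dimensional). [folklore] -/
instance instFintypeEmb : Fintype (Emb hp) :=
  minpoly.AlgHom.fintype (PadicBase F p hp) F (NormedAlgClosure F)

/-- The inclusion `F ⊆ F̄` as a `K₀`-embedding. [folklore] -/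
def emb₀ : Emb hp := IsScalarTower.toAlgHom (PadicBase F p hp) F (NormedAlgClosure F)

/-- `Emb` is nonempty. [folklore] -/
instance instNonemptyEmb : Nonempty (Emb hp) := ⟨emb₀ hp⟩

/-- **An extension `s_φ ∈ G₀` of the embedding `φ`** (`F̄/K₀` is normal and algebraic: Mathlib
`AlgHom.liftNormal`, bijective by `Algebra.IsAlgebraic.algHom_bijective`). [folklore] -/
def liftEmb (φ : Emb hp) : BaseGaloisGroup hp :=
  AlgEquiv.ofBijective (φ.liftNormal (NormedAlgClosure F))
    (Algebra.IsAlgebraic.algHom_bijective _)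

/-- `s_φ` extends `φ`. [folklore] -/
theorem liftEmb_algebraMap (φ : Emb hp) (c : F) :
    liftEmb hp φ (algebraMap F (NormedAlgClosure F) c) = φ c := by
  change φ.liftNormal (NormedAlgClosure F) (algebraMap F (NormedAlgClosure F) c) = φ c
  rw [AlgHom.liftNormal_commutes]
  rfl

/-- The permutation `φ ↦ g ∘ φ` of `Emb` by `g ∈ G₀`. [folklore] -/
def permEmb (g : BaseGaloisGroup hp) : Emb hp ≃ Emb hp where
  toFun φ := (g : NormedAlgClosure F →ₐ[PadicBase F p hp] NormedAlgClosure F).comp φ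
  invFun φ := ((g⁻¹ : BaseGaloisGroup hp) : NormedAlgClosure F →ₐ[PadicBase F p hp] NormedAlgClosure F).comp φ
  left_inv φ := by
    ext c
    change g⁻¹ (g (φ c)) = φ c
    rw [AlgEquiv.aut_inv, AlgEquiv.symm_apply_apply]
  right_inv φ := by
    ext c
    change g (g⁻¹ (φ c)) = φ c
    rw [AlgEquiv.aut_inv, AlgEquiv.apply_symm_apply]

/-- Unfolding of `permEmb`. [folklore] -/
theorem permEmb_apply (g : BaseGaloisGroup hp) (φ : Emb hp) (c : F) : permEmb hp g φ c = g (φ c) := rfl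

/-- **The correction `h_φ = s_{gφ}⁻¹ g s_φ`.** [folklore] -/
def corr (g : BaseGaloisGroup hp) (φ : Emb hp) : BaseGaloisGroup hp :=
  (liftEmb hp (permEmb hp g φ))⁻¹ * g * liftEmb hp φ

/-- `g s_φ = s_{gφ} h_φ`. [folklore] -/
theorem mul_liftEmb (g : BaseGaloisGroup hp) (φ : Emb hp) :
    g * liftEmb hp φ = liftEmb hp (permEmb hp g φ) * corr hp g φ := by
  rw [corr, ← mul_assoc, ← mul_assoc, mul_inv_cancel, one_mul]

/-- **`h_φ` fixes `F`**, i.e. `h_φ ∈ Γ_F`. [folklore] -/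
theorem corr_smul_algebraMap (g : BaseGaloisGroup hp) (φ : Emb hp) (c : F) :
    corr hp g φ • algebraMap F (NormedAlgClosure F) c = algebraMap F (NormedAlgClosure F) c := by
  rw [corr, mul_smul, mul_smul, BaseGaloisGroup.smul_def, BaseGaloisGroup.smul_def,
    BaseGaloisGroup.smul_def, liftEmb_algebraMap, AlgEquiv.aut_inv, AlgEquiv.symm_apply_eq,
    liftEmb_algebraMap, permEmb_apply]

/-- `h_φ = toBase σ_φ` for some `σ_φ ∈ Γ_F`. [folklore] -/
theorem exists_toBase_eq_corr (g : BaseGaloisGroup hp) (φ : Emb hp) :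
    ∃ σ : absoluteGaloisGroup F, BaseGaloisGroup.toBase hp σ = corr hp g φ :=
  BaseGaloisGroup.exists_toBase_eq hp _ (corr_smul_algebraMap hp g φ)

/-! ### The character `g ↦ χ(g) ∈ K₀` and its avatar in `ℂ_F` -/

/-- `W g = χ(g) ∈ K₀` (through `ℤ_pˣ → ℤ_p → K₀`), a monoid homomorphism. [folklore] -/
def W : BaseGaloisGroup hp →* PadicBase F p hp :=
  (PadicBase.ofPadicInt hp).toMonoidHom.comp
    ((Units.coeHom ℤ_[p]).comp (BaseGaloisGroup.baseCyclotomicCharacter hp))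

/-- Unfolding of `W`. [folklore] -/
theorem W_apply (g : BaseGaloisGroup hp) :
    W hp g = PadicBase.ofPadicInt hp (BaseGaloisGroup.baseCyclotomicCharacter hp g : ℤ_[p]) := rfl

/-- `W g ≠ 0` (a unit). [folklore] -/
theorem W_ne_zero (g : BaseGaloisGroup hp) : W hp g ≠ 0 :=
  norm_pos_iff.mp (by rw [W_apply, PadicBase.norm_ofPadicInt_units]; exact one_pos)

/-- `E g = ι(χ(g)) ∈ ℂ_F`. [folklore] -/
theorem E_eq (g : BaseGaloisGroup hp) :
    TateTrace.ι hp (PadicBase.ofPadicInt hp (BaseGaloisGroup.baseCyclotomicCharacter hp g : ℤ_[p])) =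
      TateTrace.ι hp (W hp g) := rfl

/-! ### The norm `y = ∏_φ s_φ • x` and its transformation law -/

/-- **Transformation of the norm.** If `h • x = ι(χ(h))^j x` for all `h ∈ Γ_F` (as elements
`toBase σ` of `G₀`), then `y = ∏_φ s_φ • x` satisfies `g • y = ι(χ(g))^{dj} y` for all `g ∈ G₀`,
`d = #Emb = [F : ℚ_p]`. [cite: Tate1967, §3.3] -/
theorem smul_norm_eq {j : ℤ} {x : CompletedAlgClosure F}
    (hx : ∀ σ : absoluteGaloisGroup F, BaseGaloisGroup.toBase hp σ • x =
      TateTrace.ι hp (W hp (BaseGaloisGroup.toBase hp σ)) ^ j * x)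
    (g : BaseGaloisGroup hp) :
    g • (∏ φ : Emb hp, liftEmb hp φ • x) =
      TateTrace.ι hp (W hp g) ^ ((Fintype.card (Emb hp) : ℤ) * j) * ∏ φ : Emb hp, liftEmb hp φ • x := by
  classical
  -- each factor: `g • s_φ • x = ι(W(h_φ)^j) * s_{gφ} • x`
  have hfac : ∀ φ : Emb hp, g • (liftEmb hp φ • x) =
      TateTrace.ι hp (W hp (corr hp g φ) ^ j) * (liftEmb hp (permEmb hp g φ) • x) := by
    intro φ
    obtain ⟨σ, hσ⟩ := exists_toBase_eq_corr hp g φ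
    have hcorr : corr hp g φ • x = TateTrace.ι hp (W hp (corr hp g φ) ^ j) * x := by
      rw [← hσ, hx σ, TateTrace.ι_zpow]
    rw [← mul_smul, mul_liftEmb, mul_smul, hcorr, smul_mul', TateTrace.base_smul_ι]
  -- the product
  have hprod : g • (∏ φ : Emb hp, liftEmb hp φ • x) = ∏ φ : Emb hp, g • (liftEmb hp φ • x) :=
    map_prod (MulSemiringAction.toRingHom (BaseGaloisGroup hp) (CompletedAlgClosure F) g) _ _
  rw [hprod, Finset.prod_congr rfl fun φ _ => hfac φ, Finset.prod_mul_distrib,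
    Equiv.prod_comp (permEmb hp g) (fun φ => liftEmb hp φ • x)]
  congr 1
  -- `∏_φ W(h_φ) = W(g)^d`
  have hW : ∀ φ : Emb hp, W hp (corr hp g φ) =
      (W hp (liftEmb hp (permEmb hp g φ)))⁻¹ * (W hp g * W hp (liftEmb hp φ)) := by
    intro φ
    rw [corr, map_mul, map_mul, map_inv, mul_assoc]
  have hP : ∏ φ : Emb hp, W hp (liftEmb hp φ) ≠ 0 :=
    Finset.prod_ne_zero_iff.mpr fun φ _ => W_ne_zero hp _
  have hWprod : ∏ φ : Emb hp, W hp (corr hp g φ) = W hp g ^ Fintype.card (Emb hp) := by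
    rw [Finset.prod_congr rfl fun φ _ => hW φ, Finset.prod_mul_distrib, Finset.prod_mul_distrib,
      Finset.prod_inv_distrib, Finset.prod_const, Finset.card_univ,
      Equiv.prod_comp (permEmb hp g) (fun φ => W hp (liftEmb hp φ))]
    field_simp
  -- the scalar: `∏_φ ι(W(h_φ)^j) = ι(W g)^{d j}`
  have h1 : ∏ φ : Emb hp, TateTrace.ι hp (W hp (corr hp g φ) ^ j) =
      TateTrace.ι hp (∏ φ : Emb hp, W hp (corr hp g φ) ^ j) := by
    simp only [← TateTrace.ιHom_apply]; exact (map_prod (TateTrace.ιHom hp) _ _).symm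
  rw [h1, Finset.prod_zpow, hWprod, TateTrace.ι_zpow, ← TateTrace.ιHom_apply, map_pow,
    TateTrace.ιHom_apply, zpow_mul, zpow_natCast]

/-- **Descent to `Γ_F`** (still phrased with `toBase σ ∈ G₀`): for `j ≠ 0`, if
`toBase σ • x = ι(χ(toBase σ))^j x` for all `σ ∈ Γ_F` then `x = 0`. [cite: Tate1967, §3.3 Theorem 2] -/
theorem eq_zero_of_forall_toBase_smul_eq {j : ℤ} (hj : j ≠ 0) {x : CompletedAlgClosure F}
    (hx : ∀ σ : absoluteGaloisGroup F, BaseGaloisGroup.toBase hp σ • x =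
      TateTrace.ι hp (W hp (BaseGaloisGroup.toBase hp σ)) ^ j * x) : x = 0 := by
  classical
  set y : CompletedAlgClosure F := ∏ φ : Emb hp, liftEmb hp φ • x with hy
  have hd : (Fintype.card (Emb hp) : ℤ) * j ≠ 0 :=
    mul_ne_zero (Nat.cast_ne_zero.mpr Fintype.card_ne_zero) hj
  have key : ∀ g : BaseGaloisGroup hp, g • y =
      TateTrace.ι hp (PadicBase.ofPadicInt hp (BaseGaloisGroup.baseCyclotomicCharacter hp g : ℤ_[p])) ^
        ((Fintype.card (Emb hp) : ℤ) * j) * y :=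
    fun g => smul_norm_eq hp hx g
  have hy0 : y = 0 := TateTrace.eq_zero_of_forall_base_smul_eq hp hd key
  obtain ⟨φ, -, hφ⟩ := Finset.prod_eq_zero_iff.mp hy0
  exact (smul_eq_zero_iff_eq (liftEmb hp φ)).mp hφ

end TateDescent

/-! ### The theorem for `Γ_F` -/

namespace CompletedAlgClosure

/-- **Tate's theorem `H⁰(Γ_F, ℂ_F(χ^{-j})) = 0` (`j ≠ 0`).** Let `F` be a non-archimedean local field
of characteristic `0` and residue characteristic `p`, `χ_F = GaloisRep.cyclotomicCharacter F p`,
and let `x ∈ ℂ_F` satisfy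
  `σ • x = χ_F(σ)^j · x`  for all `σ ∈ Γ_F`,
the scalar being the image of `χ_F(σ)^j ∈ ℤ_p` under `ℤ_p ⊆ ℚ_p → F → ℂ_F` (canonical
`LocalField.padicRingHom`). Then `x = 0`. (Tate 1967, §3.3, Theorem 2: `H⁰(K, C(χ)) = 0` for a
character `χ` of infinite order — here `χ = χ_F^{-j}`.) Proof: Ax–Sen–Tate over `ℚ_p(μ_{p^∞})`,
Tate's normalised traces, and the descent from `Gal(F̄/ℚ_p)` to `Γ_F` (`TateDescent`).
[cite: Tate1967, §3.3 Theorem 2] [cite: FontaineOuyang2022, §3.2] -/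
theorem eq_zero_of_forall_smul_eq_cyclotomicCharacter_zpow {j : ℤ} (hj : j ≠ 0)
    {x : CompletedAlgClosure F}
    (hx : ∀ σ : absoluteGaloisGroup F, σ • x =
      (algebraMap F (CompletedAlgClosure F)
        (LocalField.padicRingHom F p hp
          (((GaloisRep.cyclotomicCharacter F p σ : ℤ_[p]ˣ) : ℤ_[p]) : ℚ_[p]))) ^ j * x) :
    x = 0 := by
  refine TateDescent.eq_zero_of_forall_toBase_smul_eq hp hj (x := x) fun σ => ?_
  rw [toBase_smul_completion, hx σ, TateDescent.W_apply, BaseGaloisGroup.baseCyclotomicCharacter_toBase]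
  rfl

/-- The same statement with the twist written as `σ • x = u(σ) x`, `u(σ) = χ_F(σ)^j`, `j ∈ ℕ`,
`j ≠ 0`. [cite: Tate1967, §3.3 Theorem 2] -/
theorem eq_zero_of_forall_smul_eq_cyclotomicCharacter_pow {j : ℕ} (hj : j ≠ 0)
    {x : CompletedAlgClosure F}
    (hx : ∀ σ : absoluteGaloisGroup F, σ • x =
      (algebraMap F (CompletedAlgClosure F)
        (LocalField.padicRingHom F p hp
          (((GaloisRep.cyclotomicCharacter F p σ : ℤ_[p]ˣ) : ℤ_[p]) : ℚ_[p]))) ^ j * x) :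
    x = 0 :=
  eq_zero_of_forall_smul_eq_cyclotomicCharacter_zpow hp (j := (j : ℤ)) (Int.natCast_ne_zero.mpr hj)
    (fun σ => by rw [zpow_natCast]; exact hx σ)

/-- **`H⁰(Γ_F, ℂ_F(χ^j))` as a set**: for `j ≠ 0` the `χ_F^j`-eigenspace of `Γ_F` in `ℂ_F` is `{0}`.
[cite: Tate1967, §3.3 Theorem 2] -/
theorem twistInvariants_eq_singleton_zero {j : ℤ} (hj : j ≠ 0) :
    {x : CompletedAlgClosure F | ∀ σ : absoluteGaloisGroup F, σ • x =
      (algebraMap F (CompletedAlgClosure F)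
        (LocalField.padicRingHom F p hp
          (((GaloisRep.cyclotomicCharacter F p σ : ℤ_[p]ˣ) : ℤ_[p]) : ℚ_[p]))) ^ j * x} = {0} := by
  ext x
  simp only [Set.mem_setOf_eq, Set.mem_singleton_iff]
  constructor
  · exact eq_zero_of_forall_smul_eq_cyclotomicCharacter_zpow hp hj
  · rintro rfl σ; rw [smul_zero, mul_zero]

end CompletedAlgClosure

end Literature.NumberTheory.PAdicHodge

end
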